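import Summits.RiemannHypothesis.RiemannHypothesis.Theorems.WeilBochnerMeasureWindow
import Summits.RiemannHypothesis.RiemannHypothesis.Theorems.WeilBochnerMeasureTail
import Summits.RiemannHypothesis.RiemannHypothesis.Theorems.WeilBochnerRepresentationRungs
import Mathlib.Analysis.SpecificLimits.Normed
import HarnessLib

/-!
# RiemannHypothesis — every representing measure has EXACTLY the Riemann–von Mangoldt order of growth

Helper file (`--supports stmt-RiemannHypothesis-0098`), RH-free, standard axioms.  Seat rh-explicit
weil-3 (structure).  Complement of the growth law `μ[-T, T] = O(T log T)`
(`WeilBochnerMeasureGrowth.measure_Icc_le`): a LOWER bound of the same order.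

Let `μ` represent Weil's form on the tests of `[-b, b]` (`b > 0`).  Then (`measure_Icc_ge`)

  `μ[-T, T] ≥ c · T log T − C · T`   for all large `T`, with `c > 0`.

So window positivity at ANY fixed resolution forces the would-be spectral measure to carry mass of
order exactly `T log T` up to height `T` — the order of `N(T)`; in particular no finite or polynomially
sparser measure solves the window moment problem.

Proof.  Probe again with the plateau `g_r`, now `r = θ/T` with `θ` large: (i) LOWER energy bound
`Re Q(g_r) ≥ (r/2) log(1/(2r)) − C₁ r` (`re_weilQuadratic_plateau_ge`: for `t ∈ (2r, 1]` the translate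
`g_r(· + t)` and `g_r` have disjoint supports, so `D_t = 2‖g_r‖² ≥ 2r`, while `w(t) ≥ 1/(4t)`);
(ii) `Re Q(g_r) = ∫ ‖ĝ_r‖² dμ ≤ 4r² μ[-T, T] + ∫_{|t|>T} ‖ĝ_r‖² dμ` and the tail is
`≤ (L/2)² ∫_{|t|>T} t⁻² dμ ≤ (L²/2)(2A + 32 log 2 + 16 log T)/(T cos²1)` by `|t|‖ĝ_r‖ ≤ ∫‖g_r′‖ ≤ L/2`
(annulus bound) and the upper growth law on dyadic shells (`lintegral_sq_inv_compl_le`); (iii) choose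
`θ` so that the main term `(θ/2T) log T` beats the tail's `(8L²/cos²1)(log T)/T`.
-/

noncomputable section

set_option linter.dupNamespace false  -- the mandated namespace repeats `RiemannHypothesis`

open Complex Filter Set MeasureTheory
open scoped Real Topology ContDiff ComplexConjugate
open Literature.NumberTheory.LFunctions
open Summit.RiemannHypothesis.RiemannHypothesis.Theorems.WeilFormatC

namespace Summit.RiemannHypothesis.RiemannHypothesis.Theorems.WeilBochnerMeasure

variable {b : ℝ} {μ : Measure ℝ}

/-! ## Lower energy bound for a plateau -/

/-- `w(t) ≥ 1/(4t)` on `(0, 1]` (`w(t) ≥ e^{-t/2}/(2t)` and `e^{-1/2} ≥ 1/2`). -/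
theorem inv_four_mul_le_weilArchDensity {t : ℝ} (ht : 0 < t) (ht1 : t ≤ 1) :
    1 / (4 * t) ≤ weilArchDensity t := by
  refine le_trans ?_ (exp_neg_half_div_le_weilArchDensity ht)
  have he : (1 / 2 : ℝ) ≤ Real.exp (-(t / 2)) := by
    have h1 : Real.exp (t / 2) ≤ 2 := by
      calc Real.exp (t / 2) ≤ Real.exp (1 / 2) := Real.exp_le_exp.2 (by linarith)
        _ ≤ 2 := by
          have := Real.exp_one_lt_d9
          have h2 : Real.exp (1 / 2) ^ 2 = Real.exp 1 := by rw [← Real.exp_nat_mul]; norm_num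
          nlinarith [Real.exp_pos (1 / 2 : ℝ)]
    rw [Real.exp_neg, le_inv_comm₀ (by norm_num) (Real.exp_pos _)]
    norm_num
    exact h1
  rw [div_le_div_iff₀ (by positivity) (by positivity)]
  nlinarith

/-- **Lower energy bound for a plateau.**  There is `C₁` such that for `0 < r ≤ 1/4` and every plateau
`η` at scale `r` (`0 ≤ η ≤ 1`, `η = 1` on `|x| ≤ r/2`, `η = 0` for `|x| ≥ 3r/4`, smooth):
`(r/2) · log(1/(2r)) − C₁ r ≤ Re Q(η)` (no primes in the window `[-r, r]`; the archimedean energy over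
`t ∈ (2r, 1]`, where `D_t(η) = 2‖η‖² ≥ 2r` and `w(t) ≥ 1/(4t)`; pole form `≥ −8 sinh²(½) r²`; killing term
`≤ 2|M₀| r`). -/
theorem re_weilQuadratic_plateau_ge : ∃ C₁ : ℝ, ∀ r : ℝ, 0 < r → r ≤ 1 / 4 →
    ∀ η : ℝ → ℝ, ContDiff ℝ ∞ η → (∀ x, 0 ≤ η x ∧ η x ≤ 1) → (∀ x, |x| ≤ r / 2 → η x = 1) →
      (∀ x, 3 * r / 4 ≤ |x| → η x = 0) →
        r / 2 * Real.log (1 / (2 * r)) - C₁ * r ≤ (weilQuadratic (fun x ↦ ((η x : ℝ) : ℂ))).re := by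
  set M₀ : ℝ := weilMarkovConstant (Real.log 2 / 2) with hM₀
  refine ⟨8 * Real.sinh (1 / 2) ^ 2 + 2 * |M₀|, fun r hr hr4 η hηs hη01 hη1 hη0 ↦ ?_⟩
  have hlog2 : (1 : ℝ) / 4 ≤ Real.log 2 / 2 := by
    have := Real.log_two_gt_d9; linarith
  have hr2 : r ≤ Real.log 2 / 2 := hr4.trans hlog2
  have hr1 : r ≤ 1 := by linarith
  obtain ⟨hg, hgs⟩ := isWeilTest_plateau hηs hη0 hr
  set g : ℝ → ℂ := fun x ↦ ((η x : ℝ) : ℂ) with hgdef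
  have hgz : ∀ x, x ∉ Icc (-r) r → g x = 0 := fun x hx ↦ image_eq_zero_of_notMem_tsupport fun h ↦ hx (hgs h)
  have hgb : ∀ x, ‖g x‖ ≤ 1 := fun x ↦ by
    rw [hgdef]; simp only [Complex.norm_real, Real.norm_eq_abs, abs_le]
    exact ⟨by linarith [(hη01 x).1], (hη01 x).2⟩
  -- finer support: `tsupport g ⊆ [-3r/4, 3r/4]`
  have hgs' : tsupport g ⊆ Icc (-(3 * r / 4)) (3 * r / 4) := by
    refine closure_minimal (fun x hx ↦ ?_) isClosed_Icc
    rw [Function.mem_support, hgdef, ne_eq, Complex.ofReal_eq_zero] at hx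
    by_contra h
    rw [mem_Icc, ← abs_le, not_le] at h
    exact hx (hη0 x h.le)
  rw [weilQuadratic_re_eq_weilPoleForm_add_weilDirichletEnergy_sub hg hgs,
    GroundStateSimpleEven.par_weilDirichletEnergy_eq hr2, GroundStateSimpleEven.par_weilMarkovConstant_eq hr2,
    ← hM₀]
  have hvol : (volume (Icc (-r) r)).toReal = 2 * r := by
    rw [Real.volume_Icc, ENNReal.toReal_ofReal (by linarith)]; ring
  -- (1) `‖g‖₂² ∈ [r, 2r]`
  have hN : ∫ x : ℝ, ‖g x‖ ^ 2 ≤ 2 * r := by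
    rw [← setIntegral_eq_integral_of_forall_compl_eq_zero (s := Icc (-r) r)
      (fun x hx ↦ by rw [hgz x hx, norm_zero]; ring), ← hvol]
    have := norm_setIntegral_le_of_norm_le_const (μ := volume) (s := Icc (-r) r)
      (f := fun x ↦ ‖g x‖ ^ 2) (C := 1) (by rw [Real.volume_Icc]; exact ENNReal.ofReal_lt_top)
      fun x _ ↦ by
        rw [Real.norm_of_nonneg (by positivity)]
        calc ‖g x‖ ^ 2 ≤ 1 ^ 2 := pow_le_pow_left₀ (norm_nonneg _) (hgb x) 2
          _ = 1 := one_pow 2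
    rw [one_mul] at this
    exact (Real.le_norm_self _).trans this
  have hN0 : 0 ≤ ∫ x : ℝ, ‖g x‖ ^ 2 := integral_nonneg fun x ↦ by positivity
  have hNge : r ≤ ∫ x : ℝ, ‖g x‖ ^ 2 := by
    have hind : Integrable fun x : ℝ ↦ (Icc (-(r / 2)) (r / 2)).indicator (1 : ℝ → ℝ) x :=
      (integrable_indicator_iff measurableSet_Icc).2 (integrableOn_const (by simp [Real.volume_Icc]))
    have hcs : HasCompactSupport (fun x : ℝ ↦ ‖g x‖ ^ 2) := by
      have := (hg.2.norm).comp_left (g := fun y : ℝ ↦ y ^ 2) (by simp)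
      exact this
    have hint : Integrable fun x : ℝ ↦ ‖g x‖ ^ 2 :=
      (hg.1.continuous.norm.pow 2).integrable_of_hasCompactSupport hcs
    calc r = ∫ x, (Icc (-(r / 2)) (r / 2)).indicator (1 : ℝ → ℝ) x := by
          rw [integral_indicator_one measurableSet_Icc, Real.volume_real_Icc_of_le (by linarith)]; ring
      _ ≤ ∫ x, ‖g x‖ ^ 2 := integral_mono hind hint fun x ↦ by
          by_cases hx : x ∈ Icc (-(r / 2)) (r / 2)
          · rw [indicator_of_mem hx, Pi.one_apply, hgdef]
            simp only [hη1 x (abs_le.2 (by simpa [neg_div] using hx)), Complex.ofReal_one, norm_one, one_pow]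
            rfl
          · rw [indicator_of_notMem hx]; positivity
  -- (2) pole form `≥ −8 sinh²(½) r²`
  have hP : -(8 * Real.sinh (1 / 2) ^ 2) * r ≤ weilPoleForm g := by
    have h1 : ‖∫ x : ℝ, g x * (Real.sinh (x / 2) : ℂ)‖ ≤ Real.sinh (1 / 2) * (2 * r) := by
      rw [← setIntegral_eq_integral_of_forall_compl_eq_zero (s := Icc (-r) r)
        (fun x hx ↦ by rw [hgz x hx, zero_mul]), ← hvol]
      refine norm_setIntegral_le_of_norm_le_const (by rw [Real.volume_Icc]; exact ENNReal.ofReal_lt_top)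
        fun x hx ↦ ?_
      have hs : ‖((Real.sinh (x / 2) : ℝ) : ℂ)‖ ≤ Real.sinh (1 / 2) := by
        rw [Complex.norm_real, Real.norm_eq_abs, Real.abs_sinh]
        refine Real.sinh_le_sinh.2 ?_
        rw [abs_div, abs_two]
        rw [mem_Icc] at hx
        have : |x| ≤ 1 := abs_le.2 ⟨by linarith, by linarith⟩
        linarith
      calc ‖g x * ((Real.sinh (x / 2) : ℝ) : ℂ)‖ = ‖g x‖ * ‖((Real.sinh (x / 2) : ℝ) : ℂ)‖ := norm_mul _ _
        _ ≤ 1 * Real.sinh (1 / 2) := mul_le_mul (hgb x) hs (norm_nonneg _) zero_le_one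
        _ = Real.sinh (1 / 2) := one_mul _
    have h2 : ‖∫ x : ℝ, g x * (Real.sinh (x / 2) : ℂ)‖ ^ 2 ≤ (Real.sinh (1 / 2) * (2 * r)) ^ 2 :=
      pow_le_pow_left₀ (norm_nonneg _) h1 2
    have hr2' : r ^ 2 ≤ r := by nlinarith
    unfold weilPoleForm
    nlinarith [sq_nonneg ‖∫ x : ℝ, g x * (Real.cosh (x / 2) : ℂ)‖, sq_nonneg (Real.sinh (1 / 2)),
      mul_nonneg (sq_nonneg (Real.sinh (1 / 2))) (sub_nonneg.2 hr2')]
  -- (3) archimedean energy `≥ (r/2) log(1/(2r))`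
  have hEint : IntegrableOn (fun t ↦ weilArchDensity t * weilIncrement g t) (Ioi 0) :=
    integrableOn_weilArchDensity_mul_weilIncrement hg
  have h2r1 : 2 * r ≤ 1 := by linarith
  have hinv : IntegrableOn (fun t : ℝ ↦ t⁻¹) (Ioc (2 * r) 1) := by
    refine (ContinuousOn.integrableOn_compact isCompact_Icc ?_).mono_set Ioc_subset_Icc_self
    exact continuousOn_inv₀.mono fun t ht ↦ ne_of_gt (lt_of_lt_of_le (by positivity) ht.1)
  have hE : r / 2 * Real.log (1 / (2 * r)) ≤ ∫ t in Ioi (0 : ℝ), weilArchDensity t * weilIncrement g t := by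
    have hsub : ∫ t in Ioc (2 * r) 1, weilArchDensity t * weilIncrement g t ≤
        ∫ t in Ioi (0 : ℝ), weilArchDensity t * weilIncrement g t :=
      setIntegral_mono_set hEint
        ((ae_restrict_iff' measurableSet_Ioi).2 (Eventually.of_forall fun t (ht : t ∈ Ioi (0:ℝ)) ↦
          mul_nonneg (weilArchDensity_pos ht).le (weilIncrement_nonneg _ _)))
        (Eventually.of_forall fun t ht ↦ (Ioc_subset_Ioi_self.trans (Ioi_subset_Ioi (by linarith))) ht)
    refine le_trans ?_ hsub
    have hD : ∀ t ∈ Ioc (2 * r) 1, r / 2 * t⁻¹ ≤ weilArchDensity t * weilIncrement g t := by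
      intro t ht
      have ht0 : 0 < t := lt_trans (by positivity) ht.1
      have hDt : weilIncrement g t = 2 * ∫ x : ℝ, ‖g x‖ ^ 2 :=
        weilIncrement_eq_of_le_abs hg hgs' (by rw [abs_of_pos ht0]; linarith [ht.1])
      rw [hDt]
      calc r / 2 * t⁻¹ = 1 / (4 * t) * (2 * r) := by field_simp; ring
        _ ≤ weilArchDensity t * (2 * ∫ x : ℝ, ‖g x‖ ^ 2) :=
            mul_le_mul (inv_four_mul_le_weilArchDensity ht0 ht.2) (by linarith) (by positivity)
              (weilArchDensity_pos ht0).le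
    calc r / 2 * Real.log (1 / (2 * r)) = ∫ t in Ioc (2 * r) 1, r / 2 * t⁻¹ := by
          rw [integral_const_mul, ← intervalIntegral.integral_of_le h2r1,
            integral_inv (by
              rw [Set.uIcc_of_le h2r1, mem_Icc, not_and_or, not_le]; exact Or.inl (by positivity))]
      _ ≤ ∫ t in Ioc (2 * r) 1, weilArchDensity t * weilIncrement g t :=
          setIntegral_mono_on (hinv.const_mul _) (hEint.mono_set (Ioc_subset_Ioi_self.trans
            (Ioi_subset_Ioi (by linarith)))) measurableSet_Ioc hD
  -- (4) assembly
  have hM : -(M₀ * ∫ x : ℝ, ‖g x‖ ^ 2) ≥ -(2 * |M₀| * r) := by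
    have : M₀ * ∫ x : ℝ, ‖g x‖ ^ 2 ≤ |M₀| * (2 * r) :=
      (le_abs_self _).trans (by rw [abs_mul, abs_of_nonneg hN0]; exact mul_le_mul_of_nonneg_left hN (abs_nonneg _))
    linarith
  nlinarith [hP, hE, hM]

/-! ## The lower growth law -/

/-- **Lower growth law: `μ[-T, T] ≥ c·T log T − C·T`.**  If `μ` represents Weil's form on the tests
of `[-b, b]` (`b > 0`) then there are `c > 0`, `C` and `T₁` with
`ENNReal.ofReal (c·T·log T − C·T) ≤ μ [-T, T]` for all `T ≥ T₁`.  Together with `measure_Icc_le`: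
every solution of a window moment problem has mass of order exactly `T log T` below height `T`. -/
theorem measure_Icc_ge (hb : 0 < b)
    (hμ : ∀ g : ℝ → ℂ, IsWeilTest g → tsupport g ⊆ Icc (-b) b →
      Integrable (fun t : ℝ ↦ ‖weilMellin g (1 / 2 + t * I)‖ ^ 2) μ ∧
        weilQuadratic g = ((∫ t, ‖weilMellin g (1 / 2 + t * I)‖ ^ 2 ∂μ : ℝ) : ℂ)) :
    ∃ c C T₁ : ℝ, 0 < c ∧ ∀ T : ℝ, T₁ ≤ T →
      ENNReal.ofReal (c * T * Real.log T - C * T) ≤ μ (Icc (-T) T) := by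
  obtain ⟨L, hL0, hpl⟩ := exists_plateau
  obtain ⟨C₁, hC₁⟩ := re_weilQuadratic_plateau_ge
  obtain ⟨A, hA0, hA⟩ := measure_Icc_le hb hμ
  have hlog2 : 0 < Real.log 2 := Real.log_pos one_lt_two
  have hcos : 0 < Real.cos 1 := Real.cos_pos_of_mem_Ioo ⟨by linarith [Real.pi_gt_three],
    by linarith [Real.pi_gt_three]⟩
  -- constants: `V` bounds `|t|‖ĝ_r‖`, `θ` is the oversampling factor `r = θ/T`
  set V : ℝ := L / 2 with hV
  set θ : ℝ := 64 * V ^ 2 / Real.cos 1 ^ 2 + 2 with hθ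
  have hθ2 : 2 ≤ θ := by
    have h0 : 0 ≤ 64 * V ^ 2 / Real.cos 1 ^ 2 := by positivity
    rw [hθ]; linarith
  have hθ0 : 0 < θ := by linarith
  set K : ℝ := θ / 2 * Real.log (2 * θ) + C₁ * θ + 2 * V ^ 2 / Real.cos 1 ^ 2 * (2 * A + 32 * Real.log 2)
    with hK
  set T₀ : ℝ := max (2 / Real.log 2) (1 / b) with hT₀
  set T₁ : ℝ := max T₀ (max (4 * θ) (θ / b)) with hT₁
  refine ⟨1 / (4 * θ ^ 2), K / (4 * θ ^ 2), T₁, by positivity, fun T hT ↦ ?_⟩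
  have hT₀1 : 1 ≤ T₀ := by
    have : 1 ≤ 2 / Real.log 2 := by
      rw [le_div_iff₀ hlog2]; have := Real.log_two_lt_d9; linarith
    exact this.trans (le_max_left _ _)
  have hTT₀ : T₀ ≤ T := (le_max_left _ _).trans hT
  have hT1 : 1 ≤ T := hT₀1.trans hTT₀
  have hT0 : 0 < T := by linarith
  have hT4θ : 4 * θ ≤ T := ((le_max_left _ _).trans (le_max_right _ _)).trans hT
  have hTθb : θ / b ≤ T := ((le_max_right _ _).trans (le_max_right _ _)).trans hT
  -- the probe
  set r : ℝ := θ / T with hrdef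
  have hr : 0 < r := by positivity
  have hr4 : r ≤ 1 / 4 := by
    rw [hrdef, div_le_iff₀ hT0]; linarith
  have hrb : r ≤ b := by
    rw [hrdef, div_le_iff₀ hT0]
    have := (div_le_iff₀ hb).1 hTθb
    linarith
  have hr1 : r ≤ 1 := by linarith
  obtain ⟨η, hηs, hη01, hη1, hη0, hηL⟩ := hpl r hr
  obtain ⟨hg, hgs⟩ := isWeilTest_plateau hηs hη0 hr
  set g : ℝ → ℂ := fun x ↦ ((η x : ℝ) : ℂ) with hgdef
  obtain ⟨hFi, hQ⟩ := hμ g hg (hgs.trans (Icc_subset_Icc (by linarith) hrb))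
  set F : ℝ → ℝ := fun t ↦ ‖weilMellin g (1 / 2 + t * I)‖ ^ 2 with hF
  have hF0 : ∀ t, 0 ≤ F t := fun t ↦ by positivity
  have hQre : (weilQuadratic g).re = ∫ t, F t ∂μ := by rw [hQ, Complex.ofReal_re]
  -- (i) lower energy bound
  have hlow : r / 2 * Real.log (1 / (2 * r)) - C₁ * r ≤ ∫ t, F t ∂μ :=
    calc r / 2 * Real.log (1 / (2 * r)) - C₁ * r ≤ (weilQuadratic g).re := hC₁ r hr hr4 η hηs hη01 hη1 hη0
      _ = ∫ t, F t ∂μ := hQre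
  -- (ii) `F ≤ 4 r²` everywhere
  have hgz : ∀ x, x ∉ Icc (-r) r → g x = 0 := fun x hx ↦ image_eq_zero_of_notMem_tsupport fun h ↦ hx (hgs h)
  have hgb : ∀ x, ‖g x‖ ≤ 1 := fun x ↦ by
    rw [hgdef]; simp only [Complex.norm_real, Real.norm_eq_abs, abs_le]
    exact ⟨by linarith [(hη01 x).1], (hη01 x).2⟩
  have hvol : (volume (Icc (-r) r)).toReal = 2 * r := by
    rw [Real.volume_Icc, ENNReal.toReal_ofReal (by linarith)]; ring
  have hFle : ∀ t, F t ≤ 4 * r ^ 2 := by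
    intro t
    have h1 : ‖weilMellin g (1 / 2 + t * I)‖ ≤ 2 * r := by
      refine (norm_weilMellin_line_le_integral_norm hg.1.continuous hg.2 t).trans ?_
      rw [← setIntegral_eq_integral_of_forall_compl_eq_zero (s := Icc (-r) r)
        (fun x hx ↦ by rw [hgz x hx, norm_zero]), ← hvol]
      have h := norm_setIntegral_le_of_norm_le_const (μ := volume) (s := Icc (-r) r) (f := fun x ↦ ‖g x‖)
        (C := 1) (by rw [Real.volume_Icc]; exact ENNReal.ofReal_lt_top) fun x _ ↦ by
          rw [norm_norm]; exact hgb x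
      rw [one_mul] at h
      exact (Real.le_norm_self _).trans h
    calc F t = ‖weilMellin g (1 / 2 + t * I)‖ ^ 2 := rfl
      _ ≤ (2 * r) ^ 2 := pow_le_pow_left₀ (norm_nonneg _) h1 2
      _ = 4 * r ^ 2 := by ring
  -- (iii) `F ≤ V² t⁻²`
  have hVt : ∀ t : ℝ, |t| * ‖weilMellin g (1 / 2 + t * I)‖ ≤ V := by
    intro t
    have e1 : (fun x ↦ (η x : ℂ) * (1 : ℂ)) = g := funext fun x ↦ mul_one _
    have hint : Integrable fun x ↦ ‖deriv (fun x ↦ (η x : ℂ) * (1 : ℂ)) x‖ := by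
      rw [e1]; exact (hg.deriv.1.continuous.norm).integrable_of_hasCompactSupport hg.deriv.2.norm
    have h := integral_norm_deriv_cutoff_le (a := r) (ε := r / 4) (f := fun _ ↦ (1 : ℂ)) (S₀ := 1) (D := 0)
      (by positivity) (by linarith) ((hηs).differentiable (by simp)) hη01
      (fun x hx ↦ hη1 x (by linarith)) (fun x hx ↦ hη0 x (by linarith)) (by positivity : 0 ≤ L / r) hηL
      (differentiable_const _) (fun x _ ↦ by simp) (fun x _ ↦ by simp) hint
    rw [e1] at h
    have e2 : L / r * 1 * (2 * (r / 4)) + 0 * (2 * r) = V := by rw [hV]; field_simp; ring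
    rw [e2] at h
    exact (abs_mul_norm_weilMellin_le hg t).trans h
  have hV0 : 0 ≤ V := by rw [hV]; positivity
  have hFtail : ∀ t : ℝ, t ≠ 0 → F t ≤ V ^ 2 * (t ^ 2)⁻¹ := by
    intro t ht
    have h2 : t ^ 2 * F t ≤ V ^ 2 := by
      have := pow_le_pow_left₀ (by positivity) (hVt t) 2
      rw [mul_pow, sq_abs] at this
      exact this
    rw [← div_eq_mul_inv, le_div_iff₀ (by positivity)]
    linarith
  -- (iv) split `∫ F dμ` at height `T`
  have hsplit : ENNReal.ofReal (∫ t, F t ∂μ) ≤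
      ENNReal.ofReal (4 * r ^ 2) * μ (Icc (-T) T) +
        ENNReal.ofReal (V ^ 2) * ENNReal.ofReal (2 / (T * Real.cos 1 ^ 2) *
          (2 * A + 16 * Real.log T + 32 * Real.log 2)) := by
    rw [ofReal_integral_eq_lintegral_ofReal hFi (ae_of_all _ hF0),
      ← lintegral_add_compl (fun t ↦ ENNReal.ofReal (F t)) (measurableSet_Icc (a := -T) (b := T))]
    refine add_le_add ?_ ?_
    · calc ∫⁻ t in Icc (-T) T, ENNReal.ofReal (F t) ∂μ ≤ ∫⁻ t in Icc (-T) T, ENNReal.ofReal (4 * r ^ 2) ∂μ :=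
            setLIntegral_mono' measurableSet_Icc fun t _ ↦ ENNReal.ofReal_le_ofReal (hFle t)
        _ = ENNReal.ofReal (4 * r ^ 2) * μ (Icc (-T) T) := setLIntegral_const _ _
    · calc ∫⁻ t in (Icc (-T) T)ᶜ, ENNReal.ofReal (F t) ∂μ
          ≤ ∫⁻ t in (Icc (-T) T)ᶜ, ENNReal.ofReal (V ^ 2) * ENNReal.ofReal ((t ^ 2)⁻¹) ∂μ := by
            refine setLIntegral_mono' measurableSet_Icc.compl fun t ht ↦ ?_
            rw [← ENNReal.ofReal_mul (by positivity)]
            refine ENNReal.ofReal_le_ofReal (hFtail t ?_)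
            rw [mem_compl_iff, mem_Icc, ← abs_le, not_le] at ht
            intro h0; rw [h0, abs_zero] at ht; linarith
        _ = ENNReal.ofReal (V ^ 2) * ∫⁻ t in (Icc (-T) T)ᶜ, ENNReal.ofReal ((t ^ 2)⁻¹) ∂μ :=
            lintegral_const_mul _ ((by fun_prop : Measurable fun t : ℝ ↦ (t ^ 2)⁻¹).ennreal_ofReal)
        _ ≤ _ := by
            gcongr
            exact lintegral_sq_inv_compl_le hT1 hA0 fun R hR ↦
              hA R ((le_max_left _ _).trans (hTT₀.trans hR)) ((le_max_right _ _).trans (hTT₀.trans hR))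
  -- (v) conclude: if `μ[-T,T] = ∞` trivial; else real arithmetic
  by_cases htop : μ (Icc (-T) T) = ⊤
  · rw [htop]; exact le_top
  set m : ℝ := (μ (Icc (-T) T)).toReal with hm
  have hμm : μ (Icc (-T) T) = ENNReal.ofReal m := (ENNReal.ofReal_toReal htop).symm
  have hm0 : 0 ≤ m := ENNReal.toReal_nonneg
  set S : ℝ := 2 / (T * Real.cos 1 ^ 2) * (2 * A + 16 * Real.log T + 32 * Real.log 2) with hS
  have hlogT : 0 ≤ Real.log T := Real.log_nonneg hT1
  have hS0 : 0 ≤ S := by positivity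
  have hineq : r / 2 * Real.log (1 / (2 * r)) - C₁ * r ≤ 4 * r ^ 2 * m + V ^ 2 * S := by
    have h := (ENNReal.ofReal_le_ofReal hlow).trans hsplit
    rw [hμm, ← ENNReal.ofReal_mul (by positivity), ← ENNReal.ofReal_mul (by positivity),
      ← ENNReal.ofReal_add (by positivity) (by positivity)] at h
    exact (ENNReal.ofReal_le_ofReal_iff (by positivity)).1 h
  -- substitute `r = θ/T`, `log(1/(2r)) = log T − log(2θ)`
  have hlogr : Real.log (1 / (2 * r)) = Real.log T - Real.log (2 * θ) := by
    rw [hrdef, show 1 / (2 * (θ / T)) = T / (2 * θ) by field_simp, Real.log_div hT0.ne' (by positivity)]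
  have hTr : T * r = θ := by rw [hrdef]; field_simp
  have key : Real.log T - K ≤ 4 * θ ^ 2 * m / T := by
    have h1 := mul_le_mul_of_nonneg_left hineq hT0.le
    have e1 : T * (r / 2 * Real.log (1 / (2 * r)) - C₁ * r) =
        θ / 2 * Real.log T - (θ / 2 * Real.log (2 * θ) + C₁ * θ) := by
      rw [hlogr, show T * (r / 2 * (Real.log T - Real.log (2 * θ)) - C₁ * r) =
        (T * r) / 2 * (Real.log T - Real.log (2 * θ)) - C₁ * (T * r) by ring, hTr]; ring
    have e2 : T * (4 * r ^ 2 * m + V ^ 2 * S) =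
        4 * θ ^ 2 * m / T + 2 * V ^ 2 / Real.cos 1 ^ 2 * (2 * A + 32 * Real.log 2) +
          32 * V ^ 2 / Real.cos 1 ^ 2 * Real.log T := by
      rw [hS, hrdef]; field_simp; ring
    rw [e1, e2] at h1
    have e3 : θ / 2 - 32 * V ^ 2 / Real.cos 1 ^ 2 = 1 := by
      rw [hθ]; field_simp; ring
    have e4 : θ / 2 * Real.log T - 32 * V ^ 2 / Real.cos 1 ^ 2 * Real.log T = Real.log T := by
      rw [← sub_mul, e3, one_mul]
    rw [hK]
    linarith [h1, e4]
  -- `T log T − K T ≤ 4θ² m`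
  have key2 : T * Real.log T - K * T ≤ 4 * θ ^ 2 * m := by
    have h := (le_div_iff₀ hT0).1 key
    have e : (Real.log T - K) * T = T * Real.log T - K * T := by ring
    linarith [h, e]
  rw [hμm]
  refine ENNReal.ofReal_le_ofReal ?_
  have hθ2pos : 0 < 4 * θ ^ 2 := by positivity
  rw [show 1 / (4 * θ ^ 2) * T * Real.log T - K / (4 * θ ^ 2) * T = (T * Real.log T - K * T) / (4 * θ ^ 2) by
    field_simp]
  rw [div_le_iff₀ hθ2pos]
  linarith

/-! ## Capstone: the frontier rung as a measure of Riemann–von Mangoldt density (unconditional) -/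

/-- **At the tree's frontier rung `b = 4023/5000`, unconditionally:** there is a positive regular Borel
measure `μ` on `ℝ` which (i) reproduces Weil's explicit-formula form on every test autocorrelation with
prime side in `[-1.6092, 1.6092]`, `W(g ⋆ g̃) = ∫ ‖ĝ(½+it)‖² dμ`, and (ii) has the Riemann–von Mangoldt
order of growth from both sides: `c·T log T − C·T ≤ μ[-T, T] ≤ T(A + 8 log T)/cos²1` for all large `T`
(`c > 0`).  (`EvenWinsBeyondArch.weilPositivityOn_8046` + `WeilBochner.exists_measure_of_weilPositivityOn`
+ `measure_Icc_le` + `measure_Icc_ge`.) -/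
theorem exists_measure_density_8046 :
    ∃ μ : Measure ℝ, μ.Regular ∧
      (∀ g : ℝ → ℂ, IsWeilTest g → tsupport g ⊆ Icc (-(4023 / 5000 : ℝ)) (4023 / 5000) →
        Integrable (fun t : ℝ ↦ ‖weilMellin g (1 / 2 + t * I)‖ ^ 2) μ ∧
          weilQuadratic g = ((∫ t, ‖weilMellin g (1 / 2 + t * I)‖ ^ 2 ∂μ : ℝ) : ℂ)) ∧
      (∃ A T₀ : ℝ, ∀ T : ℝ, T₀ ≤ T →
        μ (Icc (-T) T) ≤ ENNReal.ofReal (T * (A + 8 * Real.log T) / Real.cos 1 ^ 2)) ∧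
      (∃ c C T₁ : ℝ, 0 < c ∧ ∀ T : ℝ, T₁ ≤ T →
        ENNReal.ofReal (c * T * Real.log T - C * T) ≤ μ (Icc (-T) T)) := by
  have hb : (0 : ℝ) < 4023 / 5000 := by norm_num
  obtain ⟨μ, hreg, hμ⟩ := WeilBochnerRungs.exists_measure_8046
  refine ⟨μ, hreg, hμ, ?_, measure_Icc_ge hb hμ⟩
  obtain ⟨A, -, hA⟩ := measure_Icc_le hb hμ
  exact ⟨A, max (2 / Real.log 2) (1 / (4023 / 5000 : ℝ)), fun T hT ↦
    hA T ((le_max_left _ _).trans hT) ((le_max_right _ _).trans hT)⟩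

end Summit.RiemannHypothesis.RiemannHypothesis.Theorems.WeilBochnerMeasure

end
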